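import Summits.BirchSwinnertonDyer.BirchSwinnertonDyer.Theorems.UniversalToricDescentLayerDescentFiniteKernel
import HarnessLib

/-!
# The UNIFORM kernel index at a layer: `#ker(res : H¹(G_n, A) → H¹(H, A)) ≤ [A^H : Div A^H]` when `A^{G_n}` is finite
# (crux ♭T≤ stmt-BirchSwinnertonDyer-23042, line `sigmacongruence`, stub R1 `stub_relaxedImageCount`, brick (c) IMAGE COUNT, local step F4)

Width prover `bsd-wall-utd-p1-w2` g2 under lead `bsd-wall-utd-p1` g18 (`--supports stmt-BirchSwinnertonDyer-23042`, helper). THEOREMS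
ONLY (no definition, no named fact, no `sorry`). BSD is not proved by any of this.

Setting = `…TowerDescent` / `…LayerDescentFiniteKernel` (g1): a profinite group `G`, `κ₀ : G → ℤ_p` continuous with exact index
(`κ₀ δ₁ = p^c`), `H = ker κ₀`, the layer `G_n = κ₀⁻¹(p^{c+n}ℤ_p)` (characterised by `hGn`), a discrete `p`-primary `G`-module `A`
with open stabilisers and finite `A[p]`. Width g1's `finite_ker_resOfLe_of_finite_layerFixed` proves that
`ker(res : H¹(G_n, A) → H¹(H, A)) ≅ A^H/(γ_n⁻¹ − 1)A^H` (`ProcyclicDescent.natCard_ker_resSubgroup_eq`) is FINITE when `A^{G_n}` is,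
through the lead's `…CofiniteDivisiblePart.natCard_quotient_range_le_of_finite_ker`, whose second half is the BOUND
`#(B/φB) ≤ #(B/Div B)`. This file records that bound with the right-hand side written on the `n`-INDEPENDENT group
`A^H = fixedSubgroup (kerK κ₀)` and ANY divisible part `D₀` of it (membership `∀ k ∃ c, p^k c = b`), so that it is visibly UNIFORM in the
layer — the lead's memo §2 (c): «`#ker = #A_w/(γ_n − 1)A_w ≤ [A_w : D_w] = t_v` UNIFORMLY in `n` (`γ_n − 1` is onto `D_w` because
`A^{Γ_n ∩ D_v}` is finite)»; the finiteness input at `G = D_v` is FIN (`…LayerFixedFinite.finite_layerFixed`, p689873).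

* `natCard_ker_resOfLe_le_index` — `#ker(res_n) ≤ #(A^H/D₀)` for every layer `n` with `A^{G_n}` finite;
* `exists_forall_natCard_ker_resOfLe_le` — hence ONE bound `t` (`= [A^H : Div A^H]`, `…CofiniteDivisiblePart.exists_divisiblePart`) with
  `#ker(res_n) ≤ t` for EVERY layer `n` at which `A^{G_n}` is finite.

References: [GreenbergLNM1716] §3 Lemma 3.3 (proof, p. 87: `B_v/(γ_v − 1)B_v`); [SerreGaloisCohomology1997] XIII §1; [Washington1997] §13.1.
-/

set_option autoImplicit false
-- the Theorems namespace of this sub repeats the summit name by design (D-0017 nested layout)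
set_option linter.dupNamespace false

noncomputable section

open scoped Classical

open Function
open Literature.NumberTheory.EllipticCurves
  Summit.BirchSwinnertonDyer.Rank1Residual.X11b Summit.BirchSwinnertonDyer.Rank1Residual.X11b.ProcyclicDescent
  Summit.BirchSwinnertonDyer.BirchSwinnertonDyer.Theorems.UniversalToricDescentTowerDescent
  Summit.BirchSwinnertonDyer.BirchSwinnertonDyer.Theorems.UniversalToricDescentLayerDescentFiniteKernel

universe u

namespace Summit.BirchSwinnertonDyer.BirchSwinnertonDyer.Theorems.UniversalToricDescentLayerDescentKernelIndex

section Layer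

variable {G : Type u} [Group G] [TopologicalSpace G] [IsTopologicalGroup G] [CompactSpace G] [T2Space G]
  [TotallyDisconnectedSpace G]
variable {A : Type u} [AddCommGroup A] [DistribMulAction G A] [TopologicalSpace A] [DiscreteTopology A]
variable {p : ℕ} [Fact p.Prime] (κ₀ : G →ₜ* Multiplicative ℤ_[p])
variable {c : ℕ} {δ₁ : G} (hδ₁ : (κ₀ δ₁).toAdd = (p : ℤ_[p]) ^ c)

include hδ₁ in
/-- **The uniform kernel index.** For a layer `G_n = κ₀⁻¹(p^{c+n}ℤ_p)` with `A^{G_n}` finite and ANY subgroup `D₀ ≤ A^H` (`H = ker κ₀`)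
consisting exactly of the divisible elements (`b ∈ D₀ ↔ ∀ k ∃ c, p^k c = b`), itself `p`-divisible and of finite index:
`ker(res : H¹(G_n, A) → H¹(H, A))` is finite and `#ker ≤ #(A^H/D₀)` — a bound NOT depending on `n`. (`ker ≅ A^H/(γ_n⁻¹ − 1)A^H`,
`ProcyclicDescent.natCard_ker_resSubgroup_eq`; `γ_n⁻¹ − 1` has finite kernel `⊆ A^{G_n}` on `A^H` (g1, §1–§2 of `…LayerDescentFiniteKernel`),
hence is onto `D₀` and `#(A^H/(γ_n⁻¹−1)A^H) ≤ #(A^H/D₀)` (`…CofiniteDivisiblePart.natCard_quotient_range_le_of_finite_ker`).)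
[cite: GreenbergLNM1716, §3 proof of Lemma 3.3 (p. 87)] [cite: SerreGaloisCohomology1997, XIII §1] -/
theorem natCard_ker_resOfLe_le_index {Gn : Subgroup G} {n : ℕ} (hGn : ∀ g : G, g ∈ Gn ↔ (p : ℤ_[p]) ^ (c + n) ∣ (κ₀ g).toAdd)
    (hA : ∀ a : A, IsOpen {g : G | g • a = a})
    (hAt : Literature.NumberTheory.GaloisRepresentations.IsPrimaryTorsion p A) (hGc : IsClosed (Gn : Set G))
    (hAp : Set.Finite {a : A | p • a = 0}) [Finite {a : A // ∀ g : G, g ∈ Gn → g • a = a}]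
    {D₀ : AddSubgroup (fixedSubgroup (A := A) (kerK κ₀))}
    (hD₀ : ∀ b : fixedSubgroup (A := A) (kerK κ₀), b ∈ D₀ ↔ ∀ k : ℕ, ∃ c : fixedSubgroup (A := A) (kerK κ₀), p ^ k • c = b)
    (hD₀div : ∀ d ∈ D₀, ∃ d' ∈ D₀, p • d' = d) [Finite (fixedSubgroup (A := A) (kerK κ₀) ⧸ D₀)] :
    Finite (resOfLe A (kerK_le_layer κ₀ hGn)).ker ∧
      Nat.card (resOfLe A (kerK_le_layer κ₀ hGn)).ker ≤ Nat.card (fixedSubgroup (A := A) (kerK κ₀) ⧸ D₀) := by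
  -- adapted from g1's `…LayerDescentFiniteKernel.finite_ker_resOfLe_of_finite_layerFixed` (same road, quantitative ending)
  have hp : p.Prime := Fact.out
  haveI : CompactSpace Gn := isCompact_iff_compactSpace.mp hGc.isCompact
  have hH : kerK κ₀ ≤ Gn := kerK_le_layer κ₀ hGn
  have hAn : ∀ a : A, IsOpen {g : Gn | g • a = a} := fun a ↦ (hA a).preimage continuous_subtype_val
  -- the rescaled character of `G_n`
  have hdiv : ∀ g : Gn, (p : ℤ_[p]) ^ (c + n) ∣ (κ₀.comp (subgroupIncl Gn) g).toAdd := fun g ↦ dvd_of_mem_layer κ₀ hGn g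
  let γn : Gn := ⟨δ₁ ^ p ^ n, by simpa only [mul_one] using pow_pow_mul_mem_layer κ₀ hδ₁ hGn 1⟩
  have hγn : (κ₀.comp (subgroupIncl Gn) γn).toAdd = (p : ℤ_[p]) ^ (c + n) := toAdd_apply_pow (n := n) κ₀ hδ₁
  have hsurj := ProcyclicDescent.rescale_surjective (κ₀.comp (subgroupIncl Gn)) (c + n) hdiv γn hγn
  have hone := ProcyclicDescent.rescale_eq_one (κ₀.comp (subgroupIncl Gn)) (c + n) hdiv γn hγn
  have hker : kerK (ProcyclicDescent.rescale (κ₀.comp (subgroupIncl Gn)) (c + n) hdiv) = kerK (κ₀.comp (subgroupIncl Gn)) :=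
    ProcyclicDescent.kerK_rescale (κ₀.comp (subgroupIncl Gn)) (c + n) hdiv
  -- the two kernels coincide (verbatim from `…TowerDescent.natCard_ker_resOfLe_le`)
  obtain ⟨τ, -, hτr⟩ := exists_transport (A := A) κ₀ hH
  have hkers : (resOfLe A hH).ker =
      (ResKernel.resSubgroup (kerK (ProcyclicDescent.rescale (κ₀.comp (subgroupIncl Gn)) (c + n) hdiv)) A).ker := by
    ext z
    rw [AddMonoidHom.mem_ker, AddMonoidHom.mem_ker, ← ProcyclicDescent.resOfLe_comp_resSubgroup (A := A) hker.le,
      AddMonoidHom.comp_apply]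
    constructor
    · intro h
      rw [← hτr, h, map_zero, map_zero]
    · intro h
      have h' := congrArg (resOfLe A hker.ge) h
      rw [ProcyclicDescent.resOfLe_resOfLe_of_eq (A := A) hker, map_zero, ← hτr] at h'
      exact τ.injective (by rw [h', map_zero])
  -- `B = A^{ker κ_n}` (a type), `φ = γ_n⁻¹ − 1`
  let κn := ProcyclicDescent.rescale (κ₀.comp (subgroupIncl Gn)) (c + n) hdiv
  let B : Type u := ProcyclicDescent.fixedSubgroup (A := A) (kerK κn)
  let φ : B →+ B := ProcyclicDescent.subOneFixed (A := A) (kerK κn) γn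
  -- `B` is `p`-primary with finite `p`-torsion
  have hB : ∀ b : B, ∃ m : ℕ, p ^ m • b = 0 := fun b ↦ by
    obtain ⟨m, hm⟩ := hAt (b : A)
    exact ⟨m, Subtype.ext (by rw [AddSubgroupClass.coe_nsmul, hm]; rfl)⟩
  have hfinB : Set.Finite {b : B | p • b = 0} := by
    haveI : Finite {a : A // p • a = 0} := hAp.to_subtype
    have hfin : Finite {b : B // p • b = 0} := by
      refine Finite.of_injective (fun b ↦ (⟨(b.1 : A), ?_⟩ : {a : A // p • a = 0})) ?_
      · have e := congrArg (fun x : B ↦ (x : A)) b.2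
        simp only [ZeroMemClass.coe_zero] at e
        exact e
      · intro b₁ b₂ h
        exact Subtype.ext (Subtype.ext (congrArg Subtype.val h :))
    exact Set.finite_coe_iff.mp hfin
  -- `B` and `A^H = fixedSubgroup (kerK κ₀)` are the same subgroup of `A`
  have hBB₀ : ProcyclicDescent.fixedSubgroup (A := A) (kerK κn) = ProcyclicDescent.fixedSubgroup (A := A) (kerK κ₀) := by
    ext a
    rw [ProcyclicDescent.mem_fixedSubgroup_iff, ProcyclicDescent.mem_fixedSubgroup_iff]
    constructor
    · intro h g
      have hgn : (g : G) ∈ Gn := hH g.2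
      have hmem : (⟨(g : G), hgn⟩ : Gn) ∈ kerK κn := by
        change _ ∈ kerK (ProcyclicDescent.rescale (κ₀.comp (subgroupIncl Gn)) (c + n) hdiv)
        rw [hker]; exact g.2
      exact h ⟨⟨(g : G), hgn⟩, hmem⟩
    · intro h x
      have hx : ((x : Gn) : G) ∈ kerK κ₀ := by
        have h2 : (x : Gn) ∈ kerK (κ₀.comp (subgroupIncl Gn)) := hker ▸ x.2
        exact h2
      exact h ⟨_, hx⟩
  let ψ : B ≃+ ProcyclicDescent.fixedSubgroup (A := A) (kerK κ₀) := AddEquiv.addSubgroupCongr hBB₀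
  have hψ : ∀ b : B, ((ψ b : ProcyclicDescent.fixedSubgroup (A := A) (kerK κ₀)) : A) = (b : A) := fun _ ↦ rfl
  -- the divisible part of `B`, transported from `D₀`
  let D : AddSubgroup B := D₀.comap ψ.toAddMonoidHom
  have hDmem : ∀ b : B, b ∈ D ↔ ∀ k : ℕ, ∃ c : B, p ^ k • c = b := by
    intro b
    change ψ b ∈ D₀ ↔ _
    rw [hD₀]
    constructor
    · intro h k
      obtain ⟨c₀, hc₀⟩ := h k
      refine ⟨ψ.symm c₀, ψ.injective ?_⟩
      rw [map_nsmul, AddEquiv.apply_symm_apply, hc₀]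
    · intro h k
      obtain ⟨c, hc⟩ := h k
      exact ⟨ψ c, by rw [← map_nsmul, hc]⟩
  have hDdiv : ∀ d ∈ D, ∃ d' ∈ D, p • d' = d := by
    intro d hd
    obtain ⟨d₀', hd₀', hpd⟩ := hD₀div (ψ d) hd
    refine ⟨ψ.symm d₀', ?_, ψ.injective ?_⟩
    · change ψ (ψ.symm d₀') ∈ D₀
      rwa [AddEquiv.apply_symm_apply]
    · rw [map_nsmul, AddEquiv.apply_symm_apply, hpd]
  have hidx : Nat.card (B ⧸ D) = Nat.card (ProcyclicDescent.fixedSubgroup (A := A) (kerK κ₀) ⧸ D₀) := by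
    rw [← AddSubgroup.index_eq_card, ← AddSubgroup.index_eq_card]
    exact AddSubgroup.index_comap_of_surjective D₀ ψ.surjective
  haveI : Finite (B ⧸ D) := by
    apply Nat.finite_of_card_ne_zero
    rw [hidx]
    exact Nat.card_pos.ne'
  -- `ker φ` injects into `A^{G_n}` (g1's density argument)
  have hkerφ : Set.Finite (φ.ker : Set B) := by
    have hfin : Finite φ.ker := by
      refine Finite.of_injective (fun b : φ.ker ↦ (⟨((b : B) : A), fun g hg ↦ ?_⟩ : {a : A // ∀ g : G, g ∈ Gn → g • a = a})) ?_
      · have hb0 : φ (b : B) = 0 := (AddMonoidHom.mem_ker).mp b.2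
        have hb1 : γn⁻¹ • ((b : B) : A) - ((b : B) : A) = 0 :=
          congrArg (fun x : B ↦ (x : A)) hb0
        have hb2 : γn • ((b : B) : A) = ((b : B) : A) := by
          rw [sub_eq_zero] at hb1
          conv_lhs => rw [← hb1]
          rw [smul_inv_smul]
        have hb3 : ∀ h : Gn, κn h = 1 → h • ((b : B) : A) = ((b : B) : A) := fun h hh ↦
          (ProcyclicDescent.mem_fixedSubgroup_iff (kerK κn) _).mp (b : B).2 ⟨h, hh⟩
        exact smul_eq_self_of_apply_eq_one κn hone ((b : B) : A) (hAn _) hb3 hb2 ⟨g, hg⟩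
      · intro b₁ b₂ h
        exact Subtype.ext (Subtype.ext (congrArg Subtype.val h :))
    exact Set.finite_coe_iff.mpr hfin
  obtain ⟨hfinQ, hQ⟩ :=
    UniversalToricDescentCofiniteDivisiblePart.natCard_quotient_range_le_of_finite_ker hp hB hfinB hDmem hDdiv φ hkerφ
  have hcount := ProcyclicDescent.natCard_ker_resSubgroup_eq hAn κn hsurj hone hAt
  rw [hkers]
  refine ⟨Finite.of_equiv _ (ProcyclicDescent.kerResEquiv hAn κn hsurj hone hAt).toEquiv, ?_⟩
  rw [hcount, ← hidx]
  exact hQ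

include hδ₁ in
/-- **One bound for all layers.** There is `t : ℕ` (namely `[A^H : Div A^H]`, finite because `A^H ≤ A` is `p`-primary with finite
`p`-torsion — the lead's `…CofiniteDivisiblePart.exists_divisiblePart`) such that for EVERY layer `G_n` with `A^{G_n}` finite,
`#ker(res : H¹(G_n, A) → H¹(H, A)) ≤ t`. [cite: GreenbergLNM1716, §3 proof of Lemma 3.3 (p. 87)] [cite: Washington1997, §13.1] -/
theorem exists_forall_natCard_ker_resOfLe_le (hA : ∀ a : A, IsOpen {g : G | g • a = a})
    (hAt : Literature.NumberTheory.GaloisRepresentations.IsPrimaryTorsion p A) (hAp : Set.Finite {a : A | p • a = 0}) :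
    ∃ t : ℕ, ∀ (n : ℕ) (Gn : Subgroup G) (hGn : ∀ g : G, g ∈ Gn ↔ (p : ℤ_[p]) ^ (c + n) ∣ (κ₀ g).toAdd),
      IsClosed (Gn : Set G) → Finite {a : A // ∀ g : G, g ∈ Gn → g • a = a} →
        Finite (resOfLe A (kerK_le_layer κ₀ hGn)).ker ∧ Nat.card (resOfLe A (kerK_le_layer κ₀ hGn)).ker ≤ t := by
  have hp : p.Prime := Fact.out
  let B₀ : Type u := ProcyclicDescent.fixedSubgroup (A := A) (kerK κ₀)
  have hB₀ : ∀ b : B₀, ∃ m : ℕ, p ^ m • b = 0 := fun b ↦ by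
    obtain ⟨m, hm⟩ := hAt (b : A)
    exact ⟨m, Subtype.ext (by rw [AddSubgroupClass.coe_nsmul, hm]; rfl)⟩
  have hfinB₀ : Set.Finite {b : B₀ | p • b = 0} := by
    haveI : Finite {a : A // p • a = 0} := hAp.to_subtype
    have hfin : Finite {b : B₀ // p • b = 0} := by
      refine Finite.of_injective (fun b ↦ (⟨(b.1 : A), ?_⟩ : {a : A // p • a = 0})) ?_
      · have e := congrArg (fun x : B₀ ↦ (x : A)) b.2
        simp only [ZeroMemClass.coe_zero] at e
        exact e
      · intro b₁ b₂ h
        exact Subtype.ext (Subtype.ext (congrArg Subtype.val h :))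
    exact Set.finite_coe_iff.mp hfin
  obtain ⟨D₀, -, hD₀, hD₀div, -, hfin₀⟩ := UniversalToricDescentCofiniteDivisiblePart.exists_divisiblePart (B := B₀) hB₀ hfinB₀
  haveI := hfin₀
  refine ⟨Nat.card (B₀ ⧸ D₀), fun n Gn hGn hGc hFix ↦ ?_⟩
  haveI := hFix
  exact natCard_ker_resOfLe_le_index κ₀ hδ₁ hGn hA hAt hGc hAp hD₀ hD₀div

end Layer

end Summit.BirchSwinnertonDyer.BirchSwinnertonDyer.Theorems.UniversalToricDescentLayerDescentKernelIndex

end
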